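import Summits.QuantumFields.BalabanUV.Beta.D1BFx.TorusScalarCoarseBubble
import Summits.QuantumFields.BalabanUV.Beta.D1BFx.TorusGhostPairStencils

/-!
# `BalabanUV.Beta.D1BFx.TorusScalarCoarseWords` — road «BF-x», binder row D1, slot (K), X₃(ii) ROUTE T, brick **K-TB3c PART 2, FILE 6** «COARSE-WORD ARRAYS»
# = (K4) «COARSE-2S̃−S» PART 1 (K-END-RECUT-SPEC §4∕§5): the coarse words `S̃•`∕`S•` of `GhostHalfCovariantRoad` ∕ `TorusGhostSideHalf` in the SOCKET
# CURRENCY of `KCombine.hessKer_transfer_road(_family)`: the EXPLICIT `ℤ⁴` coarse families — the one-array word `coW` (FIXED in the period) and the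
# WRAPPED two-array word `coW₂ m a s` (`s`-INDEXED: the two-array words of `S̃ₛₜ`∕`Sₛₜ` wrap around the torus through the non-local leg `GG`) with its
# `s`-UNIFORM bi-localisation and its ENTRYWISE LIMIT `coW₂lim` (the letters (u1)∕(u2) of the owner's ruling ρ-g7-8), and their periodisation identities.
# The `hessT` 4-tuple itself is assembled in FILE 7 `TorusScalarCoarseSockets`.

HONEST DEPENDENCY (cell records, verbatim): «continuum YM on T⁴ ⇐ BetaPertH ∧ nine spine estimates (0/9 proved); BetaPertH ⇐ (D1) ∧ (D4) ∧
CAP+tail; G-an2-4 gates asym, D1 and NE2/3/4.»  HONEST FRAMING (cell contract, verbatim): «discharging `BetaPertH` makes Bałaban's UV stability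
UNCONDITIONAL — a real constructive-QFT result; it is NOT the continuum limit and NOT the Clay problem.»  THIS MODULE DISCHARGES NOTHING of (K),
of D1 or of the wall: [folklore] two-scale array bookkeeping + one elementary image-tail estimate over an2's `ExpKernelCalculus` (`comp`, `BiLoc`,
`Decays`, `biLoc_comp_biLoc`), `BalabanStepJetsSucc.biLoc_comp_right`, `TameKernelCalculus.biLoc_of_le`, TA2 `PeriodicArrays` (`arr`, `decays_arr`,
`abs_arr_sub_le`, `arr_imageShift`), TA3b `TorusTraceTadpole` (`tendsto_of_abs_sub_le_imageTail`), leaf-03's `TorusGhostWordArrays`∕`TorusGhostPairStencils`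
(`perT`, `perT_add`, `arr_add`, `perT_neg`, `arr_neg`, `summable_row_arr`), PART 1 `TorusGhostLegs`∕`TorusGhostGram` (`Ggh`, `CsqK`), FILES 1–2 (`Qind`,
`QindU`, `CsqHat`), FILE 4 (`blockSumK`, `GG`, `QindU_ghost_sandwich_arr`, `QindU_mul_periodiseF_mul_QindU_transpose`, `blockSumK_arr`,
`biLoc_blockSumK`, `biLoc_sandwich`, `decays_GG`, `GG_imageShift`, `periodiseF_Ggh_mul_Ggh`) and FILE 5 (`two_array_word`, `periodiseF_toF_arr_mul_arr`)
— all USED BY NAME.  Three data definitions [our object] (`coW`, `coW₂`, `coW₂lim`); no `def … : Prop`, nothing cited, 0 sorry.  NOT D1, NOT BetaPertH,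
NOT continuum, NOT Clay.

ABSOLUTE RULE (cell charter, verbatim): «No internally-minted statement may enter as a cited fact. Every hypothesis is either kernel-proved in this
package or a verbatim quotation of a PUBLISHED theorem with page reference. The manuscript(s) under audit are NOT citable for their own disputed
steps — they are the thing under adjudication; programme-internal (2001/route/tribunal) claims are never citable.»

WHERE THIS SITS.  `GhostHalfCovariantRoad.hessT_ghost_halfCovariant_torus` (p246014) ∕ `TorusGhostSideHalf.hessT_ghost_side_half` (p246083) write the
ghost side of route T under (R2) as `2·hessT Ĝ B• + 2·hessT (c•Ĉsq) S̃• − hessT (c•Ĉsq) S•` with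
`S̃ₛ = −Q·ĜĜ·Xₛ′·ĜĜ·Qᵀ`, `S̃ₛₜ = −Q·ĜĜ·Yₛₜ′·ĜĜ·Qᵀ + Q·ĜĜ·Xₛ′·ĜĜ·Xₜ′·ĜĜ·Qᵀ + Q·ĜĜ·Xₜ′·ĜĜ·Xₛ′·ĜĜ·Qᵀ` (`Q = Qind`, fine words `X′`, `Y′`).
`KCombine.hessKer_transfer_road(_family)` wants the coarse terms as `hessT ((CsqK)^; (arr p 𝒮)^, (arr p 𝒮′)^, (arr p 𝒮₂)^)` on the coarse torus `Site 4 p × Unit`.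
For ARRAY fine words `X′ = perT s (arr s V)` (the shape leaf-03's «HALF-WORD ARRAYS» gives), THIS FILE performs that conversion: the ONE-array words are
periodised FIXED coarse arrays (FILE 4), the TWO-array words are periodised `s`-DEPENDENT coarse arrays (`coW₂ m a s`, §2–§3) whose `s → ∞` behaviour
(§1–§2) is what a uniform-in-`k` limit socket consumes.
CONTENT (d = 4, scalar road kernels `MKer 4 Unit`, `hs : s = (m+1)·p`; all [folklore]∕[our object]):
* §1 (generic `D`, `F`) **`biLoc_comp_arr`** (`X ∘ arr s Y` is bi-localised with `s`-FREE constant∕rate), **`abs_comp_arr_sub_comp_le`**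
  (`|X ∘ arr s Y − X ∘ Y| ≤ K·e^{−δ|x−p|₁}·imageTail D ((δ∕2)·s)`), **`tendsto_comp_arr`**.
* §2 [our objects] `coW m a V` (one-array coarse word), `coW₂ m a s X Y` (wrapped two-array coarse word), `coW₂lim m a X Y` (its `ℤ⁴`-born limit);
  `biLoc_coW`, **`biLoc_coW₂`** (uniform in `s`), `biLoc_coW₂lim`, **`abs_coW₂_sub_coW₂lim_le`**, **`tendsto_coW₂`**.
* §3 linearity `arr_smul`, `perT_smul`, the rectangular `Unit` re-indexing lemma `submatrix_unit_mul'`; the per-torus dictionary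
  `periodiseF_coW`, **`periodiseF_coW₂`**.
The `hessT`-level assembly (`hessT_smul_leg`, the unfibred bridges, `coarse_word₁`∕`coarse_word₂`, the MAIN `hessT_coarse_words_arr`) is FILE 7
`TorusScalarCoarseSockets` (split at the 400-line cap).
NOT HERE: (K4) PART 2 (the `n`-uniform bound `hCo`), the END's names `Sco`∕`ScoTil`, the uniform limit socket (leaf-03), the fine dictionary
`Xₛ′ = perT s (arr s Vs)` for the literal's words (one `perT_arr_mul_perT` away, leaf-03 B1).
Provenance: NE9 formalisation swarm leaf seat `b2b-balaban-t4-ne9-formalise-leaf-02` gen 27 (cross-row prover duty NE9 → β∕D1 road «BF-x»; journal CLAIM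
l.26220, NOTE N-ne9leaf02g27-1 l.26389, SHAPE l.26459), 2026-08-21.
-/

noncomputable section

namespace Summit.QuantumFields.BalabanUV.Beta.D1BFx.TorusScalarCoarseWords

open Filter Topology Finset
open scoped BigOperators Matrix
open Literature.MathematicalPhysics.QuantumFieldTheory.Balaban1983to89
open Literature.MathematicalPhysics.QuantumFieldTheory.Balaban1983to89.Beta
open Literature.MathematicalPhysics.QuantumFieldTheory.Balaban1983to89.B12Sec2to5 (l1 l1_nonneg)
open B6QGQLower276 (X blk B mem_B)
open B6QGQDecay237 (deltaU deltaU_pos)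
open B6QGGQ278Zd (deltaC deltaC_pos)
open ExpKernelCalculus (Site MKer Decays BiLoc comp Zl Zl_pos Zl_nonneg summable_exp_shift' tsum_exp_shift' biLoc_comp_biLoc)
open KernelWard (Bdd)
open BalabanStepJetsSucc (biLoc_comp_right)
open Summit.QuantumFields.BalabanUV.Beta.TameKernelCalculus (biLoc_of_le)
open SecondOrderResponse (biLoc_smul biLoc_neg)
open Summit.QuantumFields.BalabanUV.Beta.D1BFx.FibredPeriodisation (periodiseF)
open Summit.QuantumFields.BalabanUV.Beta.D1BFx.PeriodicArrays (arr toF arr_apply arr_imageShift decays_arr abs_arr_sub_le summable_arr_term)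
open Summit.QuantumFields.BalabanUV.Beta.D1BFx.TorusTraceTadpole (tendsto_of_abs_sub_le_imageTail)
open Summit.QuantumFields.BalabanUV.Beta.D1BFx.GhostLeg (Ggh)
open Summit.QuantumFields.BalabanUV.Beta.D1BFx.TorusGhostGram (CsqK)
open Summit.QuantumFields.BalabanUV.Beta.D1BFx.PeriodisedProjector (Ghat)
open Summit.QuantumFields.BalabanUV.Beta.D1BFx.TorusScalarAveraging (Qind)
open Summit.QuantumFields.BalabanUV.Beta.D1BFx.TorusScalarCoarseGram (CsqHat QindU)
open Summit.QuantumFields.BalabanUV.Beta.D1BFx.TorusScalarCoarseArrays (blockSumK blockSumK_apply GG decays_GG rate_GG_pos GG_imageShift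
  periodiseF_Ggh_mul_Ggh QindU_ghost_sandwich_arr QindU_mul_periodiseF_mul_QindU_transpose blockSumK_arr biLoc_blockSumK biLoc_sandwich)
open Summit.QuantumFields.BalabanUV.Beta.D1BFx.TorusScalarCoarseBubble (two_array_word periodiseF_toF_arr_mul_arr)
open Summit.QuantumFields.BalabanUV.Beta.D1BFx.TorusGhostWordArrays (perT perT_apply_tsum perT_add summable_row_arr arr_add bijective_prodUnit)
open Summit.QuantumFields.BalabanUV.Beta.D1BFx.TorusGhostPairStencils (perT_neg arr_neg)

/-! ## §1 The wrapped composite `X ∘ arr s Y`: `s`-uniform bi-localisation and the entrywise limit -/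

section Wrapped

variable {D : ℕ} {F : Type*} [Fintype F] {X Y : MKer D F} {p q p' q' : Site D} {C C' δ : ℝ}

/-- [folklore] **THE WRAPPED COMPOSITE IS BI-LOCALISED, UNIFORMLY IN THE PERIOD**: for `X` bi-localised at `(p, q)` and `Y` at `(p′, q′)` with a common
rate `δ > 0`, and every `s ≥ 1`, `X ∘ arr s Y` is bi-localised at `(p, q)` with rate `δ∕4` and the `s`-FREE constant
`|F|·(|C|·(C′·Zl D (δ∕2)·e^{(δ∕2)|p′−q′|₁}))·Zl D (δ∕2 − δ∕4)` (TA2 `decays_arr`: the array is an `s`-uniformly spread leg; then `biLoc_comp_right`). -/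
theorem biLoc_comp_arr (hX : BiLoc X p q C δ) (hY : BiLoc Y p' q' C' δ) (hδ : 0 < δ) (s : ℕ) [NeZero s] :
    BiLoc (comp X (arr s Y)) p q
      ((Fintype.card F : ℝ) * (|C| * (C' * Zl D (δ / 2) * Real.exp (δ / 2 * l1 (p' - q')))) * Zl D (δ / 2 - δ / 4)) (δ / 4) :=
  biLoc_comp_right (biLoc_of_le hX (half_le_self hδ.le)) (decays_arr hY hδ s) (by positivity) (by linarith)

/-- [folklore] **THE ENTRYWISE TAIL OF THE WRAPPED COMPOSITE**:
`|(X ∘ arr s Y) x z a b − (X ∘ Y) x z a b| ≤ |F|·C·|C′|·Zl D (δ∕2)·e^{(δ∕2)|q−p′|₁}·e^{−δ|x−p|₁}·imageTail D ((δ∕2)·s)` — TA2's entrywise tail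
`abs_arr_sub_le` (at the rate `δ∕2`) summed against the row of `X`. -/
theorem abs_comp_arr_sub_comp_le (hX : BiLoc X p q C δ) (hY : BiLoc Y p' q' C' δ) (hδ : 0 < δ) (s : ℕ) [NeZero s] (x z : Site D) (a b : F) :
    |comp X (arr s Y) x z a b - comp X Y x z a b| ≤
      (Fintype.card F : ℝ) * (C * |C'|) * Zl D (δ / 2) * Real.exp (δ / 2 * l1 (q - p')) * Real.exp (-δ * l1 (x - p)) * imageTail D (δ / 2 * s) := by
  classical
  have hC : 0 ≤ C := hX.nonneg a
  have hY' : BiLoc Y p' q' (|C'|) (δ / 2) := biLoc_of_le hY (half_le_self hδ.le)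
  -- both composites converge absolutely: summable rows of `X` against bounded right factors
  have hBa : Bdd (arr s Y) (C' * Zl D (δ / 2) * Real.exp (δ / 2 * l1 (p' - q'))) := PeriodicArrays.bdd_arr hY hδ s
  have hBy : Bdd Y C' := KernelWard.bdd_of_biLoc hY hδ.le
  have hrow : Summable fun y : Site D => Real.exp (-δ * l1 (y - q)) := summable_exp_shift' hδ q
  have hsum : ∀ {Z : MKer D F} {CZ : ℝ}, Bdd Z CZ → Summable fun y : Site D => ∑ f, X x y a f * Z y z f b := by
    intro Z CZ hZ
    refine Summable.of_norm_bounded (hrow.mul_left ((Fintype.card F : ℝ) * (C * Real.exp (-δ * l1 (x - p))) * CZ)) fun y => ?_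
    rw [Real.norm_eq_abs]
    calc |∑ f, X x y a f * Z y z f b| ≤ ∑ f, |X x y a f * Z y z f b| := Finset.abs_sum_le_sum_abs _ _
      _ ≤ ∑ _f : F, (C * Real.exp (-δ * l1 (x - p))) * CZ * Real.exp (-δ * l1 (y - q)) := by
          refine Finset.sum_le_sum fun f _ => ?_
          rw [abs_mul]
          calc |X x y a f| * |Z y z f b| ≤ (C * Real.exp (-δ * (l1 (x - p) + l1 (y - q)))) * CZ :=
                mul_le_mul (hX x y a f) (hZ y z f b) (abs_nonneg _) (by positivity)
            _ = _ := by rw [mul_add, Real.exp_add]; ring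
      _ = _ := by rw [Finset.sum_const, Finset.card_univ, nsmul_eq_mul]; ring
  have e : comp X (arr s Y) x z a b - comp X Y x z a b = ∑' y : Site D, ∑ f, X x y a f * (arr s Y y z f b - Y y z f b) := by
    unfold comp
    rw [← (hsum hBa).tsum_sub (hsum hBy)]
    refine tsum_congr fun y => ?_
    rw [← Finset.sum_sub_distrib]
    exact Finset.sum_congr rfl fun f _ => by ring
  rw [e]
  -- termwise majorant
  set M : ℝ := (Fintype.card F : ℝ) * (C * |C'|) * Zl D (δ / 2) * Real.exp (δ / 2 * l1 (q - p')) * Real.exp (-δ * l1 (x - p)) *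
    imageTail D (δ / 2 * s) with hM
  have hmaj : ∀ y : Site D, ‖∑ f, X x y a f * (arr s Y y z f b - Y y z f b)‖ ≤
      ((Fintype.card F : ℝ) * (C * |C'|) * Real.exp (δ / 2 * l1 (q - p')) * Real.exp (-δ * l1 (x - p)) * imageTail D (δ / 2 * s)) *
        Real.exp (-(δ / 2) * l1 (y - q)) := by
    intro y
    rw [Real.norm_eq_abs]
    have htail : ∀ f, |arr s Y y z f b - Y y z f b| ≤ |C'| * Real.exp (δ / 2 * l1 (y - p')) * imageTail D (δ / 2 * s) :=
      fun f => abs_arr_sub_le hY' (half_pos hδ) s y z f b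
    have hgeom : Real.exp (-δ * l1 (y - q)) * Real.exp (δ / 2 * l1 (y - p')) ≤ Real.exp (δ / 2 * l1 (q - p')) * Real.exp (-(δ / 2) * l1 (y - q)) := by
      rw [← Real.exp_add, ← Real.exp_add, Real.exp_le_exp]
      have htri : l1 (y - p') ≤ l1 (y - q) + l1 (q - p') := ExpKernelCalculus.l1_sub_triangle y q p'
      nlinarith [l1_nonneg (y - q), hδ]
    calc |∑ f, X x y a f * (arr s Y y z f b - Y y z f b)| ≤ ∑ f, |X x y a f * (arr s Y y z f b - Y y z f b)| := Finset.abs_sum_le_sum_abs _ _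
      _ ≤ ∑ _f : F, (C * Real.exp (-δ * (l1 (x - p) + l1 (y - q)))) * (|C'| * Real.exp (δ / 2 * l1 (y - p')) * imageTail D (δ / 2 * s)) := by
          refine Finset.sum_le_sum fun f _ => ?_
          rw [abs_mul]
          exact mul_le_mul (hX x y a f) (htail f) (abs_nonneg _) (by positivity)
      _ = (Fintype.card F : ℝ) * (C * |C'|) * imageTail D (δ / 2 * s) * Real.exp (-δ * l1 (x - p)) *
            (Real.exp (-δ * l1 (y - q)) * Real.exp (δ / 2 * l1 (y - p'))) := by
          rw [Finset.sum_const, Finset.card_univ, nsmul_eq_mul, mul_add, Real.exp_add]; ring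
      _ ≤ (Fintype.card F : ℝ) * (C * |C'|) * imageTail D (δ / 2 * s) * Real.exp (-δ * l1 (x - p)) *
            (Real.exp (δ / 2 * l1 (q - p')) * Real.exp (-(δ / 2) * l1 (y - q))) :=
          mul_le_mul_of_nonneg_left hgeom (by have := imageTail_nonneg D (δ / 2 * s); positivity)
      _ = _ := by ring
  have hst : Summable fun y : Site D =>
      ((Fintype.card F : ℝ) * (C * |C'|) * Real.exp (δ / 2 * l1 (q - p')) * Real.exp (-δ * l1 (x - p)) * imageTail D (δ / 2 * s)) *
        Real.exp (-(δ / 2) * l1 (y - q)) := (summable_exp_shift' (half_pos hδ) q).mul_left _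
  have key := tsum_of_norm_bounded hst.hasSum hmaj
  rw [Real.norm_eq_abs, tsum_mul_left, tsum_exp_shift' (c := δ / 2) q] at key
  exact key.trans_eq (by rw [hM]; ring)

/-- [folklore] **THE ENTRYWISE LIMIT OF THE WRAPPED COMPOSITE**: along any `σ k → ∞` (`σ k ≥ 1`), `(X ∘ arr (σ k) Y) x z a b → (X ∘ Y) x z a b`. -/
theorem tendsto_comp_arr (hX : BiLoc X p q C δ) (hY : BiLoc Y p' q' C' δ) (hδ : 0 < δ) {σ : ℕ → ℕ} [∀ k, NeZero (σ k)]
    (hσ : Tendsto σ atTop atTop) (x z : Site D) (a b : F) :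
    Tendsto (fun k => comp X (arr (σ k) Y) x z a b) atTop (𝓝 (comp X Y x z a b)) :=
  tendsto_of_abs_sub_le_imageTail (D := D) hσ (half_pos hδ) fun k => abs_comp_arr_sub_comp_le hX hY hδ (σ k) x z a b

end Wrapped

/-! ## §2 The coarse words of fine words at the road's legs `GG = Ggh ∘ Ggh` -/

section Words

variable (m : ℕ) (a : ℝ)

/-- [our object] **THE ONE-ARRAY COARSE WORD** of a fine word `V`: `coW m a V := blockSumK m ((GG ∘ V) ∘ GG)` — block sums of the fine vertex dressed
by the squared tower leg on both sides (FILE 4's coarse vertex of `Qind·ĜĜ·X′·ĜĜ·Qindᵀ`, named).  A definition; asserts nothing. -/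
def coW (V : MKer 4 Unit) : MKer 4 Unit := blockSumK m (comp (comp (GG m a) V) (GG m a))

/-- [our object] **THE WRAPPED TWO-ARRAY COARSE WORD** of two fine words at fine period `s`:
`coW₂ m a s X Y := blockSumK m (((GG ∘ X) ∘ GG) ∘ arr s (Y ∘ GG))` — the coarse array whose `p`-periodisation IS the torus word
`Qind·ĜĜ·Xₛ′·ĜĜ·Xₜ′·ĜĜ·Qindᵀ` (§3); it DEPENDS ON `s` through the images of the second word.  A definition; asserts nothing. -/
def coW₂ (s : ℕ) (Xk Yk : MKer 4 Unit) : MKer 4 Unit :=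
  blockSumK m (comp (comp (comp (GG m a) Xk) (GG m a)) (arr s (comp Yk (GG m a))))

/-- [our object] **THE `ℤ⁴`-BORN TWO-ARRAY COARSE WORD** (no wrap-around): `coW₂lim m a X Y := blockSumK m (((GG ∘ X) ∘ GG) ∘ (Y ∘ GG))` — the entrywise
limit of `coW₂ m a s X Y` as `s → ∞` (§2 `tendsto_coW₂`).  A definition; asserts nothing. -/
def coW₂lim (Xk Yk : MKer 4 Unit) : MKer 4 Unit :=
  blockSumK m (comp (comp (comp (GG m a) Xk) (GG m a)) (comp Yk (GG m a)))

variable {m a} {V Xk Yk : MKer 4 Unit} {P Q P' Q' : X 4} {C C' δ : ℝ}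

/-- [our object] Unfolding `coW`. -/
theorem coW_eq (V : MKer 4 Unit) : coW m a V = blockSumK m (comp (comp (GG m a) V) (GG m a)) := rfl

/-- [our object] Unfolding `coW₂`. -/
theorem coW₂_eq (s : ℕ) (Xk Yk : MKer 4 Unit) :
    coW₂ m a s Xk Yk = blockSumK m (comp (comp (comp (GG m a) Xk) (GG m a)) (arr s (comp Yk (GG m a)))) := rfl

/-- [our object] Unfolding `coW₂lim`. -/
theorem coW₂lim_eq (Xk Yk : MKer 4 Unit) : coW₂lim m a Xk Yk = blockSumK m (comp (comp (comp (GG m a) Xk) (GG m a)) (comp Yk (GG m a))) := rfl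

/-- [folklore] The rate letter of this section: `rGG m a := deltaU 4 a ∕ (4(m+1)) ∕ 2` (FILE 4 `rate_GG_pos`), and the common rate
`r₀ := min (rGG m a) δ ∕ 4` at which both dressed fine words are bi-localised. -/
theorem rate_pos (ha : 0 < a) (hδ : 0 < δ) : 0 < min (deltaU 4 a / (4 * ((m + 1 : ℕ) : ℝ)) / 2) δ / 4 := by
  have := lt_min (rate_GG_pos (m := m) ha) hδ; positivity

/-- [folklore] **THE DRESSED FIRST WORD `(GG ∘ X) ∘ GG` IS BI-LOCALISED** at `(P, Q)`, rate `min rGG δ ∕ 4` (FILE 4 `biLoc_sandwich`, the two equal leg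
rates merged). -/
theorem biLoc_dressed (ha : 0 < a) (hX : BiLoc Xk P Q C δ) (hδ : 0 < δ) :
    ∃ C₁ : ℝ, BiLoc (comp (comp (GG m a) Xk) (GG m a)) P Q C₁ (min (deltaU 4 a / (4 * ((m + 1 : ℕ) : ℝ)) / 2) δ / 4) := by
  obtain ⟨C₁, h⟩ := biLoc_sandwich (decays_GG (m := m) ha) (rate_GG_pos ha) (decays_GG ha) (rate_GG_pos ha) hX hδ
  exact ⟨C₁, by rwa [min_self] at h⟩

/-- [folklore] **THE RIGHT-DRESSED SECOND WORD `Y ∘ GG` IS BI-LOCALISED** at `(P′, Q′)`, at the same rate `min rGG δ ∕ 4` (`biLoc_comp_right` at the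
merged rate, then lowered). -/
theorem biLoc_rightDressed (ha : 0 < a) (hY : BiLoc Yk P' Q' C' δ) (hδ : 0 < δ) :
    ∃ C₂ : ℝ, BiLoc (comp Yk (GG m a)) P' Q' C₂ (min (deltaU 4 a / (4 * ((m + 1 : ℕ) : ℝ)) / 2) δ / 4) := by
  set r : ℝ := min (deltaU 4 a / (4 * ((m + 1 : ℕ) : ℝ)) / 2) δ with hr
  have hr0 : 0 < r := lt_min (rate_GG_pos (m := m) ha) hδ
  have hY' : BiLoc Yk P' Q' (|C'|) r := biLoc_of_le hY (min_le_right _ _)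
  have hG' := TameKernelCalculus.decays_of_le (δ' := r) (decays_GG (m := m) ha) (min_le_left _ _)
  have h := biLoc_comp_right hY' hG' (show (0 : ℝ) ≤ r / 4 by positivity) (by linarith)
  exact ⟨_, h⟩

/-- [folklore] **`coW m a V` IS BI-LOCALISED** at the block labels `(blk m P, blk m Q)` (FILE 4 `QindU_ghost_sandwich_arr`, second clause). -/
theorem biLoc_coW (ha : 0 < a) (hV : BiLoc V P Q C δ) (hδ : 0 < δ) :
    ∃ C₁ : ℝ, BiLoc (coW m a V) (blk m P) (blk m Q) C₁ (min (deltaU 4 a / (4 * ((m + 1 : ℕ) : ℝ)) / 2) δ / 4) := by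
  obtain ⟨C₁, h⟩ := biLoc_dressed (m := m) ha hV hδ
  exact ⟨_, biLoc_blockSumK m h (rate_pos ha hδ).le⟩

/-- [folklore] **`coW₂ m a s X Y` IS BI-LOCALISED UNIFORMLY IN `s`** — (u1) of the owner's ruling ρ-g7-8 for the coarse two-array word: ONE constant and
ONE rate (`min rGG δ ∕ 16`) at the block labels `(blk m P, blk m Q)` for EVERY fine period `s ≥ 1` (§1 `biLoc_comp_arr` + FILE 4 `biLoc_blockSumK`). -/
theorem biLoc_coW₂ (ha : 0 < a) (hX : BiLoc Xk P Q C δ) (hY : BiLoc Yk P' Q' C' δ) (hδ : 0 < δ) :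
    ∃ C₂ : ℝ, ∀ (s : ℕ) [NeZero s], BiLoc (coW₂ m a s Xk Yk) (blk m P) (blk m Q) C₂ (min (deltaU 4 a / (4 * ((m + 1 : ℕ) : ℝ)) / 2) δ / 4 / 4) := by
  obtain ⟨C₁, h₁⟩ := biLoc_dressed (m := m) ha hX hδ
  obtain ⟨C₂, h₂⟩ := biLoc_rightDressed (m := m) ha hY hδ
  exact ⟨_, fun s _ => biLoc_blockSumK m (biLoc_comp_arr h₁ h₂ (rate_pos ha hδ) s) (by have := rate_pos (m := m) ha hδ; positivity)⟩

/-- [folklore] **`coW₂lim m a X Y` IS BI-LOCALISED** at the block labels (an2's `biLoc_comp_biLoc` + FILE 4 `biLoc_blockSumK`). -/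
theorem biLoc_coW₂lim (ha : 0 < a) (hX : BiLoc Xk P Q C δ) (hY : BiLoc Yk P' Q' C' δ) (hδ : 0 < δ) :
    ∃ C₂ : ℝ, BiLoc (coW₂lim m a Xk Yk) (blk m P) (blk m Q') C₂ (min (deltaU 4 a / (4 * ((m + 1 : ℕ) : ℝ)) / 2) δ / 4) := by
  obtain ⟨C₁, h₁⟩ := biLoc_dressed (m := m) ha hX hδ
  obtain ⟨C₂, h₂⟩ := biLoc_rightDressed (m := m) ha hY hδ
  exact ⟨_, biLoc_blockSumK m (biLoc_comp_biLoc h₁ h₂ (rate_pos ha hδ)) (rate_pos ha hδ).le⟩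

/-- [folklore] **THE ENTRYWISE TAIL OF THE WRAPPED COARSE WORD** — (u2) quantitatively: for every `s ≥ 1` and all coarse sites,
`|coW₂ m a s X Y y y′ − coW₂lim m a X Y y y′| ≤ K · imageTail 4 ((min rGG δ ∕ 8)·s)` with an `s`-FREE `K` (§1 `abs_comp_arr_sub_comp_le` summed over
the `(m+1)⁴ × (m+1)⁴` fine pairs of the two blocks, the localisation factor `e^{−r|x−P|₁} ≤ 1` discarded). -/
theorem abs_coW₂_sub_coW₂lim_le (ha : 0 < a) (hX : BiLoc Xk P Q C δ) (hY : BiLoc Yk P' Q' C' δ) (hδ : 0 < δ) :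
    ∃ K : ℝ, ∀ (s : ℕ) [NeZero s] (y y' : X 4) (u v : Unit),
      |coW₂ m a s Xk Yk y y' u v - coW₂lim m a Xk Yk y y' u v| ≤ K * imageTail 4 (min (deltaU 4 a / (4 * ((m + 1 : ℕ) : ℝ)) / 2) δ / 4 / 2 * s) := by
  obtain ⟨C₁, h₁⟩ := biLoc_dressed (m := m) ha hX hδ
  obtain ⟨C₂, h₂⟩ := biLoc_rightDressed (m := m) ha hY hδ
  set r : ℝ := min (deltaU 4 a / (4 * ((m + 1 : ℕ) : ℝ)) / 2) δ / 4 with hr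
  have hr0 : 0 < r := rate_pos (m := m) ha hδ
  set K₀ : ℝ := (Fintype.card Unit : ℝ) * (C₁ * |C₂|) * Zl 4 (r / 2) * Real.exp (r / 2 * l1 (Q - P')) with hK₀
  have hK₀nn : 0 ≤ K₀ := by
    have := h₁.nonneg (); have := Zl_nonneg (D := 4) (half_pos hr0); positivity
  refine ⟨((m : ℝ) + 1) ^ 4 * ((m : ℝ) + 1) ^ 4 * K₀, fun s _ y y' u v => ?_⟩
  rw [coW₂_eq, coW₂lim_eq, blockSumK_apply, blockSumK_apply, ← Finset.sum_sub_distrib]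
  simp_rw [← Finset.sum_sub_distrib]
  have hterm : ∀ x ∈ B m y, ∀ x' ∈ B m y',
      |comp (comp (comp (GG m a) Xk) (GG m a)) (arr s (comp Yk (GG m a))) x x' () () -
          comp (comp (comp (GG m a) Xk) (GG m a)) (comp Yk (GG m a)) x x' () ()| ≤ K₀ * imageTail 4 (r / 2 * s) := by
    intro x _ x' _
    refine (abs_comp_arr_sub_comp_le h₁ h₂ hr0 s x x' () ()).trans ?_
    have h1 : Real.exp (-r * l1 (x - P)) ≤ 1 := Real.exp_le_one_iff.mpr (by nlinarith [l1_nonneg (x - P)])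
    have := imageTail_nonneg 4 (r / 2 * s)
    calc (Fintype.card Unit : ℝ) * (C₁ * |C₂|) * Zl 4 (r / 2) * Real.exp (r / 2 * l1 (Q - P')) * Real.exp (-r * l1 (x - P)) * imageTail 4 (r / 2 * s)
        = K₀ * Real.exp (-r * l1 (x - P)) * imageTail 4 (r / 2 * s) := by rw [hK₀]
      _ ≤ K₀ * 1 * imageTail 4 (r / 2 * s) := by gcongr
      _ = _ := by ring
  calc |∑ x ∈ B m y, ∑ x' ∈ B m y', (comp (comp (comp (GG m a) Xk) (GG m a)) (arr s (comp Yk (GG m a))) x x' () () -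
          comp (comp (comp (GG m a) Xk) (GG m a)) (comp Yk (GG m a)) x x' () ())|
      ≤ ∑ x ∈ B m y, ∑ x' ∈ B m y', |comp (comp (comp (GG m a) Xk) (GG m a)) (arr s (comp Yk (GG m a))) x x' () () -
          comp (comp (comp (GG m a) Xk) (GG m a)) (comp Yk (GG m a)) x x' () ()| :=
        (Finset.abs_sum_le_sum_abs _ _).trans (Finset.sum_le_sum fun x _ => Finset.abs_sum_le_sum_abs _ _)
    _ ≤ ∑ x ∈ B m y, ∑ x' ∈ B m y', K₀ * imageTail 4 (r / 2 * s) :=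
        Finset.sum_le_sum fun x hx => Finset.sum_le_sum fun x' hx' => hterm x hx x' hx'
    _ = _ := by
        rw [B6QGQLower276.sum_B_const, B6QGQLower276.sum_B_const]; ring

/-- [folklore] **THE ENTRYWISE LIMIT OF THE WRAPPED COARSE WORD** — (u2) of ρ-g7-8: along any `s k → ∞` (`s k ≥ 1`),
`coW₂ m a (s k) X Y y y′ u v → coW₂lim m a X Y y y′ u v`. -/
theorem tendsto_coW₂ (ha : 0 < a) (hX : BiLoc Xk P Q C δ) (hY : BiLoc Yk P' Q' C' δ) (hδ : 0 < δ) {σ : ℕ → ℕ} [∀ k, NeZero (σ k)]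
    (hσ : Tendsto σ atTop atTop) (y y' : X 4) (u v : Unit) :
    Tendsto (fun k => coW₂ m a (σ k) Xk Yk y y' u v) atTop (𝓝 (coW₂lim m a Xk Yk y y' u v)) := by
  obtain ⟨K, hK⟩ := abs_coW₂_sub_coW₂lim_le (m := m) ha hX hY hδ
  exact tendsto_of_abs_sub_le_imageTail (D := 4) hσ (by have := rate_pos (m := m) ha hδ; positivity) fun k => hK (σ k) y y' u v

end Words

/-! ## §3 The per-torus dictionary: the coarse words are periodised coarse arrays (`s = (m+1)·p`, `× Unit` currency) -/

section Linear

variable {D : ℕ} {F : Type*}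

/-- [folklore] The array is homogeneous: `arr s (c • V) = c • arr s V` (unconditional: `tsum_mul_left`). -/
theorem arr_smul (s : ℕ) (c : ℝ) (V : MKer D F) : arr s (c • V) = c • arr s V := by
  funext x y a b
  simp only [arr_apply, Pi.smul_apply, smul_eq_mul]
  exact tsum_mul_left

/-- [folklore] `perT` is homogeneous: `perT s (c • K) = c • perT s K` (unconditional). -/
theorem perT_smul (s : ℕ) [NeZero s] (c : ℝ) (K : MKer 4 Unit) : perT s (c • K) = c • perT s K := by
  ext x z
  simp only [perT_apply_tsum, Matrix.smul_apply, Pi.smul_apply, smul_eq_mul]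
  exact tsum_mul_left

/-- [folklore] The `Unit` re-indexing `y ↦ (y, ())` is a bijection (any index type). -/
theorem bijective_prodUnit' (β : Type*) : Function.Bijective (fun y : β => (y, ())) :=
  ⟨fun _ _ h => congrArg Prod.fst h, fun ⟨y, _⟩ => ⟨y, rfl⟩⟩

/-- [folklore] Re-indexed products, rectangular form: `M.sub · N.sub = (M · N).sub` along the `Unit` re-indexings. -/
theorem submatrix_unit_mul' {α β γ : Type*} [Fintype β] (M : Matrix (α × Unit) (β × Unit) ℝ) (N : Matrix (β × Unit) (γ × Unit) ℝ) :
    M.submatrix (fun x => (x, ())) (fun y => (y, ())) * N.submatrix (fun y => (y, ())) (fun z => (z, ()))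
      = (M * N).submatrix (fun x => (x, ())) (fun z => (z, ())) :=
  (Matrix.submatrix_mul M N _ _ _ (bijective_prodUnit' β)).symm

end Linear

section Dictionary

variable {m : ℕ} {a : ℝ} {s p : ℕ} [NeZero s] [NeZero p] {V Xk Yk : MKer 4 Unit} {P Q P' Q' : X 4} {C C' δ : ℝ}

/-- [folklore] **THE ONE-ARRAY COARSE WORD ON THE TORUS** (FILE 4 `QindU_ghost_sandwich_arr`, first clause, under the name `coW`):
`QindU · ĜĜ·(arr s V)^·ĜĜ · QindUᵀ = (arr p (coW m a V))^`. -/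
theorem periodiseF_coW (ha : 0 < a) (hs : s = (m + 1) * p) (hV : BiLoc V P Q C δ) (hδ : 0 < δ) :
    QindU (m + 1) s p *
        (Matrix.of (periodiseF s (toF (Ggh (m + 1) a))) * Matrix.of (periodiseF s (toF (Ggh (m + 1) a)))
          * Matrix.of (periodiseF s (toF (arr s V)))
          * (Matrix.of (periodiseF s (toF (Ggh (m + 1) a))) * Matrix.of (periodiseF s (toF (Ggh (m + 1) a)))))
      * (QindU (m + 1) s p)ᵀ
      = Matrix.of (periodiseF p (toF (arr p (coW m a V)))) :=
  (QindU_ghost_sandwich_arr ha hs hV hδ).1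

/-- [folklore] **THE WRAPPED TWO-ARRAY COARSE WORD ON THE TORUS**: for bi-localised fine words `X`, `Y` at a common rate and `s = (m+1)·p`,
`QindU · ĜĜ·(arr s X)^·ĜĜ·(arr s Y)^·ĜĜ · QindUᵀ = (arr p (coW₂ m a s X Y))^` — FILE 5 `two_array_word` (two arrays), FILE 5
`periodiseF_toF_arr_mul_arr` (ONE array of the wrapped composite), FILE 4's two-scale unfold and `blockSumK_arr` at §1's `s`-uniform bi-localisation. -/
theorem periodiseF_coW₂ (ha : 0 < a) (hs : s = (m + 1) * p) (hX : BiLoc Xk P Q C δ) (hY : BiLoc Yk P' Q' C' δ) (hδ : 0 < δ) :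
    QindU (m + 1) s p *
        (Matrix.of (periodiseF s (toF (Ggh (m + 1) a))) * Matrix.of (periodiseF s (toF (Ggh (m + 1) a)))
          * Matrix.of (periodiseF s (toF (arr s Xk)))
          * (Matrix.of (periodiseF s (toF (Ggh (m + 1) a))) * Matrix.of (periodiseF s (toF (Ggh (m + 1) a))))
          * Matrix.of (periodiseF s (toF (arr s Yk)))
          * (Matrix.of (periodiseF s (toF (Ggh (m + 1) a))) * Matrix.of (periodiseF s (toF (Ggh (m + 1) a)))))
      * (QindU (m + 1) s p)ᵀ
      = Matrix.of (periodiseF p (toF (arr p (coW₂ m a s Xk Yk)))) := by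
  have hG := decays_GG (m := m) ha
  have hGr := rate_GG_pos (m := m) ha
  have hGper := GG_imageShift (m := m) (a := a) ha hs
  obtain ⟨C₁, h₁⟩ := biLoc_dressed (m := m) ha hX hδ
  obtain ⟨C₂, h₂⟩ := biLoc_rightDressed (m := m) ha hY hδ
  have hr0 := rate_pos (m := m) ha hδ
  have hW := biLoc_comp_arr h₁ h₂ hr0 s
  have hr4 : 0 < min (deltaU 4 a / (4 * ((m + 1 : ℕ) : ℝ)) / 2) δ / 4 / 4 := by positivity
  rw [coW₂_eq, periodiseF_Ggh_mul_Ggh ha hs, two_array_word hG hGr hGper hG hGr hGper hG hGr hGper hX hY hδ,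
    periodiseF_toF_arr_mul_arr h₁ h₂ hr0,
    QindU_mul_periodiseF_mul_QindU_transpose hs _ (fun x y t => arr_imageShift s _ x y t () ()) (summable_row_arr s hW hr4),
    blockSumK_arr hs hW hr4]

end Dictionary

end Summit.QuantumFields.BalabanUV.Beta.D1BFx.TorusScalarCoarseWords

end
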